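import Literature.MeasureTheory.Group.PadicIntHaar
import Mathlib.MeasureTheory.Measure.Haar.Unique
import Mathlib.MeasureTheory.Constructions.Pi
import HarnessLib

/-!
# Scaling of the Haar measure of `ℤ_p` (and `ℤ_pⁿ`) under injective additive endomorphisms:
# `μ_p(a·S) = |a|_p μ_p(S)`, `μ(T(S)) = μ(T(ℤ_pⁿ)) μ(S)`

Topic `Literature/MeasureTheory/Group`; continues `PadicIntHaar.lean` (the normalised Haar measure
`volume` on `ℤ_[p]`, `μ_p(pⁿℤ_p) = p⁻ⁿ`). Everything here is PROVED (no named facts).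

The `p`-adic volume computations of arithmetic statistics (e.g. M. Bhargava, A. Shankar, Ann. of
Math. 181 (2015), §2.5 "each `d`-dimensional volume is scaled by a factor of `1/m^d` to reflect the
fact that our new lattice has been scaled by a factor of `m`", and the `p`-adic change-of-measure
formula of their §3.4, Props. 3.11–3.12 of the published version, whose Jacobian constant enters as
`|𝒥|_p`) rest on the fact that the additive Haar measure of `ℚ_p` transforms under `x ↦ ax` by the
module `|a|_p`, and that of `ℚ_pⁿ` under a linear map `A` by `|det A|_p`. This file proves the
mechanism behind all such statements and its first instances:

* `measure_image_addMonoidHom_eq` — **for a compact second-countable Hausdorff additive group `G`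
  with Haar probability measure `μ` and a continuous injective additive endomorphism `T`,
  `μ(T(S)) = μ(T(G)) · μ(S)` for every `S ⊆ G`** (the measure `S ↦ μ(T(S))` is left
  invariant and finite, hence a multiple of `μ` by the uniqueness of Haar measure; the multiple is
  read off at `S = G`); `measure_image_addEquiv_eq`: continuous additive automorphisms preserve `μ`.
* `padicInt_range_mulLeft`, `padicInt_volume_range_mulLeft` — `aℤ_p = p^{v(a)}ℤ_p` has measure
  `p^{−v(a)} = |a|_p` (`ennnorm_eq_inv_pow_valuation`).
* `padicInt_volume_image_mul_left` — **`μ_p(a·S) = p^{−v(a)} μ_p(S) = |a|_p μ_p(S)`** for `a ≠ 0`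
  and every `S ⊆ ℤ_p` (`padicInt_volume_image_mul_left'` with `‖a‖₊`; `padicInt_volume_image_pow_mul`
  for `a = pᵏ`).
* `padicInt_pi_volume_image_eq`, `padicInt_pi_volume_image_diag` — on `ℤ_pⁿ = ι → ℤ_[p]` with the
  product measure: `μ(T(S)) = μ(T(ℤ_pⁿ)) μ(S)` for continuous injective additive `T` and any `S`, and for the
  diagonal map `x ↦ (aᵢxᵢ)ᵢ`, `μ(T(S)) = ∏ᵢ p^{−v(aᵢ)} · μ(S)`; `padicInt_pi_volume_image_addEquiv`
  (e.g. the action of `GLₙ(ℤ_p)`) preserves the measure.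

(The general formula `μ(A·S) = |det A|_p μ(S)` for `A ∈ Mₙ(ℤ_p)`, `det A ≠ 0`, is
`padicInt_pi_volume_image_eq` plus the index computation `μ(Aℤ_pⁿ) = |det A|_p`, i.e. the Smith
normal form over `ℤ_p`; it is not needed here and not proved.)

## References

* A. Weil, *Basic Number Theory*, Ch. I §2 (the module of an automorphism; `mod(a) = |a|_p`);
  N. Bourbaki, *Intégration*, Ch. VII §1 no. 10. [folklore]
* M. Bhargava, A. Shankar, Ann. of Math. (2) 181 (2015) 191–242, §2.5 and §3.4 (published
  numbering) for the use. [cite: BhargavaShankarAnnals2015, §2.5 (scaling of p-adic volumes; arXiv:1006.1002v2 numbering)]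

## Design

As in `PadicIntHaar.lean`: path namespace `Literature.MeasureTheory.Group`, `padicInt_` prefixes,
no new instances; the abstract lemma is stated for an arbitrary compact group so as to
apply verbatim to `ℤ_p`, `ℤ_pⁿ` and to coefficient spaces such as `V_{ℤ_p}`.
-/

noncomputable section

open MeasureTheory MeasureTheory.Measure Set TopologicalSpace
open scoped ENNReal NNReal Pointwise

namespace Literature.MeasureTheory.Group

/-! ## The abstract scaling lemma on a compact group -/

section Abstract

variable {G : Type*} [AddCommGroup G] [TopologicalSpace G] [IsTopologicalAddGroup G]
  [CompactSpace G] [T2Space G] [SecondCountableTopology G] [MeasurableSpace G] [BorelSpace G]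

/-- **Scaling of Haar measure under an injective continuous additive endomorphism.** Let `G` be a
compact second-countable Hausdorff (additive, commutative) group with Haar probability measure `μ`,
and `T : G →+ G` continuous and injective. Then `μ(T(S)) = μ(T(G)) · μ(S)` for every measurable
`S ⊆ G` (no measurability needed): the measure `S ↦ μ(T(S))` (the pull-back of `μ` along the
closed embedding `T`) is invariant under translations and finite, hence equals `c · μ` by uniqueness
of Haar measure, and `c = μ(T(G))`.
[folklore] -/
theorem measure_image_addMonoidHom_eq (μ : Measure G) [μ.IsAddHaarMeasure] [IsProbabilityMeasure μ]
    (T : G →+ G) (hT : Continuous T) (hinj : Function.Injective T) (S : Set G) :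
    μ (T '' S) = μ (range T) * μ S := by
  have hemb : MeasurableEmbedding T := (hT.isClosedEmbedding hinj).measurableEmbedding
  set ν : Measure G := μ.comap T with hν
  have hνapp : ∀ s, ν s = μ (T '' s) := fun s ↦ hemb.comap_apply μ s
  -- translation invariance of `ν`
  haveI : ν.IsAddLeftInvariant := by
    refine ⟨fun g ↦ ?_⟩
    ext s hs
    rw [Measure.map_apply (measurable_const_add g) hs, hνapp, hνapp]
    have h1 : (fun x ↦ g + x) ⁻¹' s = (fun x ↦ -g + x) '' s := by
      rw [image_add_left, neg_neg]
    have h2 : T '' ((fun x ↦ -g + x) '' s) = (fun y ↦ T (-g) + y) '' (T '' s) := by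
      rw [image_image, image_image]
      refine image_congr fun x _ ↦ ?_
      rw [map_add]
    rw [h1, h2, image_add_left, measure_preimage_add]
  haveI : IsFiniteMeasure ν := ⟨by rw [hνapp]; exact measure_lt_top μ _⟩
  -- uniqueness of Haar measure, for `ν` and for `μ`
  have hνu := congrArg (fun m : Measure G ↦ m S) (addHaarMeasure_unique ν (⊤ : PositiveCompacts G))
  have hμu := congrArg (fun m : Measure G ↦ m S) (addHaarMeasure_unique μ (⊤ : PositiveCompacts G))
  simp only [Measure.smul_apply, smul_eq_mul, PositiveCompacts.coe_top, measure_univ, one_mul] at hνu hμu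
  rw [← hνapp, hνu, hνapp, image_univ, hμu]

/-- A continuous additive automorphism of a compact group preserves the Haar probability measure.
[folklore] -/
theorem measure_image_addEquiv_eq (μ : Measure G) [μ.IsAddHaarMeasure] [IsProbabilityMeasure μ]
    (e : G ≃+ G) (he : Continuous e) (S : Set G) : μ (e '' S) = μ S := by
  have h := measure_image_addMonoidHom_eq μ e.toAddMonoidHom he e.injective S
  simp only [AddEquiv.coe_toAddMonoidHom] at h
  rw [h, EquivLike.range_eq_univ, measure_univ, one_mul]

end Abstract

/-! ## `ℤ_p`: `μ_p(a·S) = |a|_p · μ_p(S)` -/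

section PadicInt

variable {p : ℕ} [Fact p.Prime]

/-- `aℤ_p = p^{v(a)}ℤ_p` for `a ≠ 0` (`a = u p^{v(a)}`, `u` a unit). [folklore] -/
theorem padicInt_range_mulLeft {a : ℤ_[p]} (ha : a ≠ 0) :
    range (fun x : ℤ_[p] ↦ a * x) =
      ((Ideal.span {(p : ℤ_[p]) ^ a.valuation} : Ideal ℤ_[p]) : Set ℤ_[p]) := by
  have hassoc : Associated ((p : ℤ_[p]) ^ a.valuation) a :=
    ⟨PadicInt.unitCoeff ha, by rw [mul_comm]; exact (PadicInt.unitCoeff_spec ha).symm⟩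
  have hspan : (Ideal.span {a} : Ideal ℤ_[p]) = Ideal.span {(p : ℤ_[p]) ^ a.valuation} :=
    Ideal.span_singleton_eq_span_singleton.mpr hassoc.symm
  ext x
  rw [mem_range, SetLike.mem_coe, ← hspan, Ideal.mem_span_singleton']
  constructor
  · rintro ⟨y, rfl⟩; exact ⟨y, mul_comm y a⟩
  · rintro ⟨y, rfl⟩; exact ⟨y, mul_comm a y⟩

/-- `μ_p(aℤ_p) = p^{−v(a)}` for `a ≠ 0`. [folklore] -/
theorem padicInt_volume_range_mulLeft {a : ℤ_[p]} (ha : a ≠ 0) :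
    volume (range (fun x : ℤ_[p] ↦ a * x)) = ((p : ℝ≥0∞) ^ a.valuation)⁻¹ := by
  rw [padicInt_range_mulLeft ha, padicInt_volume_span_pow]

/-- `|a|_p = p^{−v(a)}` in `ℝ≥0∞`. [folklore] -/
theorem ennnorm_eq_inv_pow_valuation {a : ℤ_[p]} (ha : a ≠ 0) :
    (‖a‖₊ : ℝ≥0∞) = ((p : ℝ≥0∞) ^ a.valuation)⁻¹ := by
  have hp : (0 : ℝ) < p := by exact_mod_cast (Fact.out : p.Prime).pos
  have h1 : (‖a‖₊ : ℝ≥0∞) = ENNReal.ofReal ‖a‖ := by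
    rw [ENNReal.ofReal]
    congr 1
    apply NNReal.eq
    rw [Real.coe_toNNReal _ (norm_nonneg _), coe_nnnorm]
  rw [h1, PadicInt.norm_eq_zpow_neg_valuation ha, zpow_neg, zpow_natCast,
    ENNReal.ofReal_inv_of_pos (pow_pos hp _), ENNReal.ofReal_pow hp.le, ENNReal.ofReal_natCast]

/-- Multiplication by `a ≠ 0` on `ℤ_p` is a continuous injective additive endomorphism. [folklore] -/
theorem padicInt_continuous_injective_mulLeft {a : ℤ_[p]} (ha : a ≠ 0) :
    Continuous (AddMonoidHom.mulLeft a : ℤ_[p] → ℤ_[p]) ∧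
      Function.Injective (AddMonoidHom.mulLeft a : ℤ_[p] → ℤ_[p]) :=
  ⟨continuous_const.mul continuous_id, mul_right_injective₀ ha⟩

/-- **`μ_p(a·S) = p^{−v(a)} μ_p(S)`** for `a ∈ ℤ_p ∖ {0}` and measurable `S ⊆ ℤ_p`: the Haar
measure of `ℤ_p` transforms under `x ↦ ax` by the module `|a|_p` (Weil, *Basic Number Theory*,
Ch. I §2); here for `a ∈ ℤ_p ∖ {0}` and every `S ⊆ ℤ_p`. [folklore] -/
theorem padicInt_volume_image_mul_left {a : ℤ_[p]} (ha : a ≠ 0) (S : Set ℤ_[p]) :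
    volume ((fun x ↦ a * x) '' S) = ((p : ℝ≥0∞) ^ a.valuation)⁻¹ * volume S := by
  obtain ⟨hc, hi⟩ := padicInt_continuous_injective_mulLeft ha
  have h := measure_image_addMonoidHom_eq (volume : Measure ℤ_[p]) (AddMonoidHom.mulLeft a) hc hi S
  simp only [AddMonoidHom.coe_mulLeft] at h
  rw [h, padicInt_volume_range_mulLeft ha]

/-- `μ_p(a·S) = |a|_p μ_p(S)` (with the `p`-adic absolute value). [folklore] -/
theorem padicInt_volume_image_mul_left' {a : ℤ_[p]} (ha : a ≠ 0) (S : Set ℤ_[p]) :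
    volume ((fun x ↦ a * x) '' S) = (‖a‖₊ : ℝ≥0∞) * volume S := by
  rw [padicInt_volume_image_mul_left ha S, ennnorm_eq_inv_pow_valuation ha]

/-- `μ_p(pᵏ·S) = p⁻ᵏ μ_p(S)`. [folklore] -/
theorem padicInt_volume_image_pow_mul (k : ℕ) (S : Set ℤ_[p]) :
    volume ((fun x ↦ (p : ℤ_[p]) ^ k * x) '' S) = ((p : ℝ≥0∞) ^ k)⁻¹ * volume S := by
  have hpk : (p : ℤ_[p]) ^ k ≠ 0 := pow_ne_zero _ (NeZero.ne _)
  rw [padicInt_volume_image_mul_left hpk S, PadicInt.valuation_pow, PadicInt.valuation_p, mul_one]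

/-- A unit of `ℤ_p` has valuation `0`. [folklore] -/
theorem padicInt_valuation_unit (u : ℤ_[p]ˣ) : (u : ℤ_[p]).valuation = 0 := by
  have hu : ‖(u : ℤ_[p])‖ = 1 := PadicInt.isUnit_iff.mp (Units.isUnit u)
  rw [PadicInt.norm_eq_zpow_neg_valuation (Units.ne_zero u)] at hu
  have hp : (1 : ℝ) < p := by exact_mod_cast (Fact.out : p.Prime).one_lt
  have := (zpow_eq_one_iff_right₀ (zero_le_one.trans hp.le) hp.ne').mp hu
  omega

/-- Multiplication by a unit preserves `μ_p`. [folklore] -/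
theorem padicInt_volume_image_unit_mul (u : ℤ_[p]ˣ) (S : Set ℤ_[p]) :
    volume ((fun x ↦ (u : ℤ_[p]) * x) '' S) = volume S := by
  rw [padicInt_volume_image_mul_left (Units.ne_zero u) S, padicInt_valuation_unit u, pow_zero,
    inv_one, one_mul]

end PadicInt

/-! ## `ℤ_pⁿ`: injective additive endomorphisms, diagonal maps, automorphisms -/

section Pi

variable {p : ℕ} [Fact p.Prime] {ι : Type*} [Fintype ι]

/-- **`μ(T(S)) = μ(T(ℤ_pⁿ)) · μ(S)`** on `ℤ_pⁿ = ι → ℤ_[p]` (product of the normalised Haar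
measures) for a continuous injective additive endomorphism `T` and every `S`. [folklore] -/
theorem padicInt_pi_volume_image_eq (T : (ι → ℤ_[p]) →+ (ι → ℤ_[p])) (hT : Continuous T)
    (hinj : Function.Injective T) (S : Set (ι → ℤ_[p])) :
    volume (T '' S) = volume (range T) * volume S :=
  measure_image_addMonoidHom_eq volume T hT hinj S

/-- A continuous additive automorphism of `ℤ_pⁿ` (e.g. the action of an element of `GLₙ(ℤ_p)`)
preserves the measure. [folklore] -/
theorem padicInt_pi_volume_image_addEquiv (e : (ι → ℤ_[p]) ≃+ (ι → ℤ_[p])) (he : Continuous e)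
    (S : Set (ι → ℤ_[p])) : volume (e '' S) = volume S :=
  measure_image_addEquiv_eq volume e he S

omit [Fintype ι] in
/-- The range of the diagonal map `x ↦ (aᵢxᵢ)ᵢ` of `ℤ_pⁿ` is the box `∏ᵢ aᵢℤ_p`. [folklore] -/
theorem padicInt_pi_range_diag (a : ι → ℤ_[p]) :
    range (fun (x : ι → ℤ_[p]) (i : ι) ↦ a i * x i) = Set.pi univ (fun i ↦ range fun x : ℤ_[p] ↦ a i * x) := by
  ext y
  simp only [mem_range, mem_univ_pi]
  constructor
  · rintro ⟨x, rfl⟩ i; exact ⟨x i, rfl⟩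
  · intro h
    choose x hx using h
    exact ⟨x, funext hx⟩

/-- **`μ((aᵢxᵢ)ᵢ-image of S) = ∏ᵢ p^{−v(aᵢ)} · μ(S)`** on `ℤ_pⁿ`, for `aᵢ ≠ 0`: the diagonal case
of "`μ(A·S) = |det A|_p μ(S)`". [folklore] -/
theorem padicInt_pi_volume_image_diag (a : ι → ℤ_[p]) (ha : ∀ i, a i ≠ 0)
    (S : Set (ι → ℤ_[p])) :
    volume ((fun (x : ι → ℤ_[p]) (i : ι) ↦ a i * x i) '' S) =
      (∏ i, ((p : ℝ≥0∞) ^ (a i).valuation)⁻¹) * volume S := by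
  let T : (ι → ℤ_[p]) →+ (ι → ℤ_[p]) :=
    { toFun := fun x i ↦ a i * x i
      map_zero' := by funext i; simp
      map_add' := fun x y ↦ by funext i; simp [mul_add] }
  have hT : Continuous T := by
    apply continuous_pi
    intro i
    exact continuous_const.mul (continuous_apply i)
  have hinj : Function.Injective T := by
    intro x y h
    funext i
    have := congrFun h i
    exact mul_right_injective₀ (ha i) this
  have h := padicInt_pi_volume_image_eq T hT hinj S
  have hcoe : (T : (ι → ℤ_[p]) → (ι → ℤ_[p])) = fun x i ↦ a i * x i := rfl
  rw [hcoe] at h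
  rw [h, padicInt_pi_range_diag, volume_pi, Measure.pi_pi]
  congr 1
  exact Finset.prod_congr rfl fun i _ ↦ padicInt_volume_range_mulLeft (ha i)

/-- `μ(pᵏ·S) = p^{−kn} μ(S)` on `ℤ_pⁿ` ("each `d`-dimensional volume is scaled by a factor of
`1/m^d`", Bhargava–Shankar §2.5, at `m = pᵏ`). [cite: BhargavaShankarAnnals2015, §2.5 (arXiv:1006.1002v2 numbering)] -/
theorem padicInt_pi_volume_image_pow_smul (k : ℕ) (S : Set (ι → ℤ_[p])) :
    volume ((fun (x : ι → ℤ_[p]) ↦ (p : ℤ_[p]) ^ k • x) '' S) =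
      ((p : ℝ≥0∞) ^ (k * Fintype.card ι))⁻¹ * volume S := by
  have hpk : (p : ℤ_[p]) ^ k ≠ 0 := pow_ne_zero _ (NeZero.ne _)
  have hfun : (fun (x : ι → ℤ_[p]) ↦ (p : ℤ_[p]) ^ k • x) =
      fun (x : ι → ℤ_[p]) (i : ι) ↦ (fun _ : ι ↦ (p : ℤ_[p]) ^ k) i * x i := by
    funext x i; simp [Pi.smul_apply, smul_eq_mul]
  rw [hfun, padicInt_pi_volume_image_diag (fun _ ↦ (p : ℤ_[p]) ^ k) (fun _ ↦ hpk) S]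
  congr 1
  rw [Finset.prod_const, PadicInt.valuation_pow, PadicInt.valuation_p, mul_one, Finset.card_univ,
    ← ENNReal.inv_pow, ← pow_mul]

end Pi

end Literature.MeasureTheory.Group

end
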